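/-
COR-CM (cell pub-hodgecm2, stage 2 of the Hodge ladder): heal bridge between the cell's CM-type Hodge structure
`CMTypeHodge.hodge` (b14, `Model/CMTypeUniverse.lean`) and the Literature object `HodgeStructure.ofCMType`
(b16, `Literature/AlgebraicGeometry/Motives/HodgeStructureOfCMType.lean`).  Seat prover-pub-hodgecm2-b16 (gen 10),
2026-08-20, per the lead's ruling of 2026-08-20T22:49:25Z (the Literature name is the long-term home; the CorCM copy
stays as the model universe's internal; this file proves they agree so no consumer has to choose).
-/
import Summits.HodgeConjecture.CorCM.Model.CMTypeUniverse
import Literature.AlgebraicGeometry.Motives.HodgeStructureOfCMTypePolarization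
import HarnessLib

/-!
# Bridge: `CMTypeHodge.hodge E Φ = HodgeStructure.ofCMType Φ`

Two constructions of the weight-one `ℚ`-Hodge structure of a CM type `(E; Φ)` on `V = E` exist in the tree:

* the cell-internal `Summit.HodgeConjecture.CorCM.CMTypeHodge.hodge E Φ` (`Model/CMTypeUniverse.lean`):
  `ofSplitting` of `holPart E Φ = ⨆_{σ ∈ Φ} eigenLine E σ`, the eigen-lines of the multiplication action read through
  the tree's `EndAction` discharges;
* the Literature `Literature.AlgebraicGeometry.Motives.HodgeStructure.ofCMType Φ`
  (`Motives/HodgeStructureOfCMType.lean`): `ofSplitting` of the coordinate subspace `coordSubspace E Φ.1` in the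
  eigen-coordinates `RealMult.embCoords : ℂ ⊗_ℚ E ≃ ℂ^{Hom(E,ℂ)}`.

They are EQUAL (`hodge_eq_ofCMType`): the eigen-line `eigenLine E σ` is the coordinate line `coordSubspace E {σ}`
(`HodgeStructure.iInf_eigenspace_lmul`, same defining infimum), so `holPart E Φ ≤ coordSubspace E Φ.1`, and two
subspaces `A ≤ B` each complementary to its complex conjugate coincide.  Consequently the Hodge pieces, the
`E`-actions (same `ι = Algebra.lmul ℚ E`), eigen-pieces, multiplicities, CM type and `IsCM` agree, and every fact
proved for the Literature object (effectivity, Hodge numbers, `cmType = Φ`, `IsCM`, polarizability —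
`Motives/HodgeStructureOfCMTypePolarization.lean`) transfers to `CMTypeHodge.hodge` by rewriting
(`isEffective_hodge`, `cmType_action`, `isCM_action`, `isPolarizable_hodge`).  New consumers
outside `CorCM/` should use the Literature name directly.
-/

noncomputable section

open scoped TensorProduct

namespace Summit.HodgeConjecture.CorCM

namespace CMTypeHodge

open Literature.AlgebraicGeometry.Motives (CMType HodgeStructure)
open Literature.AlgebraicGeometry.Motives

variable (E : Type) [Field E] [NumberField E] (Φ : CMType E)

/-- Two subspaces `A ≤ B`, each complementary to some `A' ≤ B'`, are equal. -/
private theorem eq_of_le_of_isCompl {M : Type*} [AddCommGroup M] [Module ℂ M] {A A' B B' : Submodule ℂ M}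
    (hAB : A ≤ B) (hA'B' : A' ≤ B') (hA : IsCompl A A') (hB : IsCompl B B') : A = B := by
  refine le_antisymm hAB fun b hb => ?_
  have hb' : b ∈ A ⊔ A' := by
    rw [hA.sup_eq_top]
    exact Submodule.mem_top
  obtain ⟨a, ha, a', ha', rfl⟩ := Submodule.mem_sup.1 hb'
  have ha'B : a' ∈ B := by
    have h := B.sub_mem hb (hAB ha)
    rwa [add_sub_cancel_left] at h
  have ha'0 : a' ∈ B ⊓ B' := ⟨ha'B, hA'B' ha'⟩
  rw [hB.inf_eq_bot, Submodule.mem_bot] at ha'0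
  rw [ha'0, add_zero]
  exact ha

/-- **The eigen-line `L_σ` of `CMTypeUniverse` is the coordinate line `ℂ_σ` of the Literature file** (same defining
infimum of eigenspaces of the multiplication action; `HodgeStructure.iInf_eigenspace_lmul`). -/
theorem eigenLine_eq_coordSubspace (σ : E →+* ℂ) :
    eigenLine E σ = HodgeStructure.coordSubspace E {σ} :=
  HodgeStructure.iInf_eigenspace_lmul σ

/-- **`H^{1,0}` agrees**: `holPart E Φ = ⊕_{φ ∈ Φ} ℂ_φ = coordSubspace E Φ.1`. -/
theorem holPart_eq_coordSubspace : holPart E Φ = HodgeStructure.coordSubspace E Φ.1 := by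
  have hle : holPart E Φ ≤ HodgeStructure.coordSubspace E Φ.1 := by
    refine Finset.sup_le fun σ hσ => ?_
    rw [eigenLine_eq_coordSubspace]
    intro x hx τ hτ
    exact hx τ fun h => hτ (by rw [Set.mem_singleton_iff.1 h]; exact (mem_holIndex E Φ).1 hσ)
  exact eq_of_le_of_isCompl hle (HodgeStructure.complexConj_mono hle) (isCompl_holPart E Φ)
    (HodgeStructure.isCompl_coordSubspace_cmType_complexConj Φ)

/-- **The two weight-one Hodge structures of the CM type `(E; Φ)` coincide**:
`CMTypeHodge.hodge E Φ = HodgeStructure.ofCMType Φ` (both are `ofSplitting` of the same `H^{1,0}`). -/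
theorem hodge_eq_ofCMType : hodge E Φ = HodgeStructure.ofCMType Φ := by
  apply HodgeStructure.ext
  funext j
  change HodgeStructure.twoStepFiltration (holPart E Φ) 1 j = (HodgeStructure.ofCMType Φ).F j
  rw [HodgeStructure.ofCMType_F, holPart_eq_coordSubspace]

/-- The Hodge pieces agree: `(hodge E Φ).piece p q = (ofCMType Φ).piece p q` for all `p, q`. -/
theorem piece_eq_piece_ofCMType (p q : ℤ) :
    (hodge E Φ).piece p q = (HodgeStructure.ofCMType Φ).piece p q := by
  rw [hodge_eq_ofCMType]

/-- The two `E`-actions have the same structure map `ι = Algebra.lmul ℚ E`. -/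
theorem action_ι_eq : (action E Φ).ι = (HodgeStructure.endActionOfCMType Φ).ι := rfl

/-- The eigen-pieces of the two `E`-actions agree. -/
theorem eigenPiece_action_eq (σ : E →+* ℂ) (p q : ℤ) :
    (action E Φ).eigenPiece σ p q = (HodgeStructure.endActionOfCMType Φ).eigenPiece σ p q := by
  rw [HodgeStructure.EndAction.eigenPiece, HodgeStructure.EndAction.eigenPiece, piece_eq_piece_ofCMType]
  rfl

/-- The multiplicities `n_σ` of the two `E`-actions agree. -/
theorem multiplicity_action_eq (σ : E →+* ℂ) :
    (action E Φ).multiplicity σ = (HodgeStructure.endActionOfCMType Φ).multiplicity σ := by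
  rw [HodgeStructure.EndAction.multiplicity, HodgeStructure.EndAction.multiplicity, eigenPiece_action_eq]

/-- **The CM type of the cell's action is `Φ`** (transferred from `HodgeStructure.cmType_endActionOfCMType`). -/
theorem cmType_action : (action E Φ).cmType = Φ.1 := by
  rw [← HodgeStructure.cmType_endActionOfCMType Φ]
  ext σ
  rw [HodgeStructure.EndAction.mem_cmType_iff, HodgeStructure.EndAction.mem_cmType_iff, multiplicity_action_eq]

/-- **The cell's Hodge structure is effective** (transferred from `HodgeStructure.isEffective_ofCMType`). -/
theorem isEffective_hodge : (hodge E Φ).IsEffective := by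
  rw [hodge_eq_ofCMType]
  exact HodgeStructure.isEffective_ofCMType Φ

/-- `h^{1,0}(hodge E Φ) = [E : ℚ]/2` (transferred from `HodgeStructure.hodgeNumber_one_zero_ofCMType`). -/
theorem hodgeNumber_one_zero_hodge : (hodge E Φ).hodgeNumber 1 0 = Module.finrank ℚ E / 2 := by
  rw [hodge_eq_ofCMType]
  exact HodgeStructure.hodgeNumber_one_zero_ofCMType Φ

/-- **The cell's action is of CM type** (`EndAction.IsCM`) for a CM field `E` (transferred from
`HodgeStructure.isCM_endActionOfCMType`). -/
theorem isCM_action [NumberField.IsCMField E] : (action E Φ).IsCM :=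
  ⟨isEffective_hodge E Φ, ‹NumberField.IsCMField E›, HodgeStructure.finrank_eq_one_endActionOfCMType Φ⟩

/-- **The cell's CM-type Hodge structure is polarizable** for every CM type of a CM field (transferred from
`HodgeStructure.isPolarizable_ofCMType`, seat b18's Riemann form `Tr_{E/ℚ}(ζ x̄ y)`; step (1) of the D5 assembly
`h₃ ⇐ Riemann 6.20`). -/
theorem isPolarizable_hodge [NumberField.IsCMField E] : (hodge E Φ).IsPolarizable := by
  rw [hodge_eq_ofCMType]
  exact HodgeStructure.isPolarizable_ofCMType Φ

end CMTypeHodge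

end Summit.HodgeConjecture.CorCM

end
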